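import Mathlib.RingTheory.Regular.Flat
import Mathlib.RingTheory.Ideal.Height
import Mathlib.RingTheory.Ideal.MinimalPrime.Basic
import Mathlib.RingTheory.Localization.AtPrime.Basic
import Mathlib.RingTheory.Localization.Submodule
import Mathlib.Data.List.OfFn
import Literature.AlgebraicGeometry.Resolution.CohenMacaulaySystemsOfParameters
import HarnessLib

/-!
# Cohen–Macaulayness localizes (Matsumura, Thm. 17.3 (iii); Bruns–Herzog, Thm. 2.1.3 (b))

Topic: `Literature/AlgebraicGeometry/Resolution`. Sequel of `CohenMacaulaySystemsOfParameters.lean`.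
For a Noetherian local ring `(R, 𝔪)` that is Cohen–Macaulay — every system of parameters is a
weakly regular sequence, equivalently there is a regular sequence in `𝔪` of length `dim R` —
every localization `R_P` at a prime `P` is again Cohen–Macaulay (Matsumura, *Commutative Ring
Theory*, Thm. 17.3 (iii): "`A_𝔭` is CM for every `𝔭 ∈ Spec A`"). This is the algebra behind
"Cohen–Macaulayness is stable under localization, so it suffices to bound the depth at each CLOSED
point" in the proofs of Macaulayfication (Kawasaki 2000, proof of Thm. 4.1; Česnavičius 2021,
proof of Thm. 3.13, citing EGA IV₁ 0.16.5.10 (i)); the scheme-level consequence is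
`CohenMacaulayClosedPoints.lean`.

Ideal-theoretic proof (no `Ext`, no local cohomology), all PROVED:

* `exists_mem_le_height_sup_span_singleton`, `exists_forall_mem_and_le_height` — prime
  avoidance: if `r ≤ ht J` and `r + e ≤ ht I` (Noetherian ring) there are `t₁,…,tₑ ∈ I` with
  `r + e ≤ ht (J + (t))`;
* `exists_isSystemOfParameters_append` — every prime `P` of a Noetherian local ring contains the
  head `x` (`h = ht P` elements) of a system of parameters `(x, t)` and is minimal over `(x)`;
* `exists_isRegular_of_isLocalization_atPrime` — **Matsumura 17.3 (iii)**: for `R` Cohen–Macaulay,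
  `x` is weakly regular on `R` (head of a weakly regular s.o.p.), so its image in any localization
  `S = R_P` is an `S`-regular sequence in `𝔪_S` of length `h = ht P = dim S`: `S` is
  Cohen–Macaulay;
* `cmClause_of_isLocalization_atPrime` — the same in the inline clause of the Macaulayfication
  facts: if every system of parameters of `R` is weakly regular, so is every system of parameters
  of `S`, for ANY `[IsLocalization.AtPrime S P]` (not only the model `Localization.AtPrime P`).

The statements were first proved summit-side for route `FrobeniusLadder` of
`ResolutionOfSingularities` (`Summit…FInjectiveMacaulayfication.SopThroughPrime`,
`….CmLocalizes`); this is their Literature home.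

## References

* [Matsumura1987] H. Matsumura, *Commutative Ring Theory*, CUP 1986, Thm. 17.3 (iii), 17.4 (iii).
* [BrunsHerzog1998] W. Bruns, J. Herzog, *Cohen–Macaulay rings*, Thm. 2.1.3 (b).
-/

namespace Literature.AlgebraicGeometry.Resolution

open IsLocalRing RingTheory.Sequence Literature.RingTheory.TightClosure

universe u

/-! ## Prime avoidance: a prime is minimal over the head of a system of parameters -/

section Noetherian

variable {R : Type u} [CommRing R] [IsNoetherianRing R]

/-- **The prime avoidance step.** In a Noetherian ring, if `r ≤ ht J` (every minimal prime of `J`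
has height `≥ r`) and `r < ht I`, then some `y ∈ I` has `r + 1 ≤ ht (J + (y))`: choose `y`
outside the finitely many minimal primes of `J` of height exactly `r` (none of them contains `I`);
a minimal prime `Q` of `J + (y)` of height `r` would be a minimal prime of `J` of height `r`
containing `y`. [folklore] -/
theorem exists_mem_le_height_sup_span_singleton (I J : Ideal R) (r : ℕ)
    (hJ : (r : ℕ∞) ≤ J.height) (hI : (r : ℕ∞) < I.height) :
    ∃ y ∈ I, (r : ℕ∞) + 1 ≤ (J ⊔ Ideal.span {y}).height := by
  -- the minimal primes of `J` of height exactly `r`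
  set S : Set (Ideal R) := {K | K ∈ J.minimalPrimes ∧ K.height = r} with hS
  have hSfin : S.Finite := J.finite_minimalPrimes_of_isNoetherianRing.subset fun _ h => h.1
  -- prime avoidance: `I ⊄ ⋃ S`
  have havoid : ¬ ((I : Set R) ⊆ ⋃ K ∈ S, (K : Set R)) := by
    rw [Ideal.subset_union_prime_finite hSfin I I (fun K hK _ _ => hK.1.1.1)]
    rintro ⟨K, hKS, hle⟩
    have h := hI.trans_le (Ideal.height_mono hle)
    rw [hKS.2] at h
    exact lt_irrefl _ h
  obtain ⟨y, hyI, hy⟩ := Set.not_subset.mp havoid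
  have hy' : ∀ K ∈ S, y ∉ K := fun K hK hyK => hy (Set.mem_biUnion hK hyK)
  refine ⟨y, hyI, ?_⟩
  rw [(J ⊔ Ideal.span {y}).height_eq_inf_minimalPrimes]
  refine le_iInf₂ fun Q hQ => ?_
  have hQp : Q.IsPrime := hQ.1.1
  have hJQ : J ≤ Q := le_sup_left.trans hQ.1.2
  have hyQ : y ∈ Q := hQ.1.2 (Ideal.mem_sup_right (Ideal.mem_span_singleton_self y))
  have hrQ : (r : ℕ∞) ≤ Q.height := hJ.trans (Ideal.height_mono hJQ)
  rcases hrQ.lt_or_eq with hlt | heq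
  · exact Order.add_one_le_of_lt hlt
  · -- `ht Q = r`: `Q` is a minimal prime of `J` of height `r` containing `y`
    exact absurd hyQ
      (hy' Q ⟨Ideal.mem_minimalPrimes_of_height_eq hJQ (heq.ge.trans hJ), heq.symm⟩)

/-- **Iterated prime avoidance.** In a Noetherian ring, if `r ≤ ht J` and `r + e ≤ ht I`, then
there are `t₁, …, tₑ ∈ I` with `r + e ≤ ht (J + (t₁, …, tₑ))`. [folklore] -/
theorem exists_forall_mem_and_le_height (I J : Ideal R) (r : ℕ) (hJ : (r : ℕ∞) ≤ J.height) :
    ∀ e : ℕ, ((r + e : ℕ) : ℕ∞) ≤ I.height →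
      ∃ t : Fin e → R, (∀ j, t j ∈ I) ∧
        ((r + e : ℕ) : ℕ∞) ≤ (J ⊔ Ideal.span (Set.range t)).height := by
  intro e
  induction e with
  | zero =>
    intro _
    refine ⟨Fin.elim0, fun j => j.elim0, ?_⟩
    rw [Set.range_eq_empty, Ideal.span_empty, sup_bot_eq, Nat.add_zero]
    exact hJ
  | succ e ih =>
    intro hI
    have hlt : ((r + e : ℕ) : ℕ∞) < I.height := by
      refine lt_of_lt_of_le ?_ hI
      exact_mod_cast Nat.lt_succ_self (r + e)
    obtain ⟨t, htI, ht⟩ := ih hlt.le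
    obtain ⟨y, hyI, hy⟩ :=
      exists_mem_le_height_sup_span_singleton I (J ⊔ Ideal.span (Set.range t)) (r + e) ht hlt
    refine ⟨Fin.snoc t y, fun j => ?_, ?_⟩
    · refine Fin.lastCases ?_ (fun j => ?_) j
      · rw [Fin.snoc_last]
        exact hyI
      · rw [Fin.snoc_castSucc]
        exact htI j
    · rw [Fin.range_snoc, Ideal.span_insert, sup_comm (Ideal.span {y}), ← sup_assoc,
        ← add_assoc, Nat.cast_succ]
      exact hy

end Noetherian

/-- **A prime is minimal over the head of a system of parameters.** In a Noetherian local ring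
`R`, every prime `P` contains the first `h = ht P` members `x` of some system of parameters
`Fin.append x t` of `R` and is a minimal prime of `(x)`: choose `x₁, x₂, … ∈ P` successively
outside the minimal primes of height `l` of the ideal generated by the first `l` of them (prime
avoidance, possible while `l < ht P`), then continue inside `𝔪` up to `d = dim R` elements; the
ideal `(x₁, …, x_d) ⊆ 𝔪` has height `d`, so it is `𝔪`-primary (the choice made in
Matsumura's proof of Thm. 17.3 (iii)). [cite: Matsumura1987, Thm. 17.3 (iii) (proof)] -/
theorem exists_isSystemOfParameters_append (R : Type u) [CommRing R] [IsNoetherianRing R]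
    [IsLocalRing R] (P : Ideal R) [P.IsPrime] :
    ∃ (h e : ℕ) (x : Fin h → R) (t : Fin e → R),
      IsSystemOfParameters (Fin.append x t) ∧ (∀ i, x i ∈ P) ∧
      P ∈ (Ideal.span (Set.range x)).minimalPrimes ∧ P.height = h := by
  -- finite heights: `h = ht P ≤ ht 𝔪 = dim R = h + e`
  obtain ⟨h, hh⟩ := ENat.ne_top_iff_exists.mp (Ideal.height_ne_top_of_isPrime (I := P))
  obtain ⟨d, hd⟩ :=
    ENat.ne_top_iff_exists.mp (Ideal.height_ne_top_of_isPrime (I := maximalIdeal R))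
  have hPm : P ≤ maximalIdeal R := le_maximalIdeal (Ideal.IsPrime.ne_top ‹_›)
  have hhd : h ≤ d := by
    have hle := Ideal.height_mono hPm
    rw [← hh, ← hd] at hle
    exact_mod_cast hle
  obtain ⟨e, rfl⟩ := Nat.exists_eq_add_of_le hhd
  have hdim : ringKrullDim R = ((h + e : ℕ) : WithBot ℕ∞) := by
    rw [← maximalIdeal_height_eq_ringKrullDim, ← hd]
    rfl
  -- the head `x ⊆ P`: `h` prime avoidance steps inside `P`, starting from `⊥`
  obtain ⟨x, hxP, hx⟩ :=
    exists_forall_mem_and_le_height P ⊥ 0 (by simp) h (by rw [Nat.zero_add, hh])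
  rw [Nat.zero_add, bot_sup_eq] at hx
  have hxle : Ideal.span (Set.range x) ≤ P := Ideal.span_le.mpr (Set.range_subset_iff.mpr hxP)
  have hPmin : P ∈ (Ideal.span (Set.range x)).minimalPrimes :=
    Ideal.mem_minimalPrimes_of_height_eq hxle (hh.ge.trans hx)
  -- the tail `t ⊆ 𝔪`: `e` more prime avoidance steps inside `𝔪`, starting from `(x)`
  obtain ⟨t, htm, ht⟩ :=
    exists_forall_mem_and_le_height (maximalIdeal R) (Ideal.span (Set.range x)) h hx e hd.le
  refine ⟨h, e, x, t, ?_, hxP, hPmin, hh.symm⟩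
  -- `(x, t) ≤ 𝔪` has height `≥ h + e = ht 𝔪`, so `𝔪` is minimal over it: a system of parameters
  rw [isSystemOfParameters_iff_mem_minimalPrimes]
  refine ⟨hdim, ?_⟩
  -- the range of an appended family (`range_fin_append` of `AlterationsEnlargingZ.lean`,
  -- re-proved inline to keep the imports small)
  have range_fin_append' : Set.range (Fin.append x t) = Set.range x ∪ Set.range t := by
    ext a
    constructor
    · rintro ⟨i, rfl⟩
      refine Fin.addCases (fun j => ?_) (fun j => ?_) i
      · exact Or.inl ⟨j, (Fin.append_left x t j).symm⟩
      · exact Or.inr ⟨j, (Fin.append_right x t j).symm⟩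
    · rintro (⟨j, rfl⟩ | ⟨j, rfl⟩)
      · exact ⟨Fin.castAdd e j, Fin.append_left x t j⟩
      · exact ⟨Fin.natAdd h j, Fin.append_right x t j⟩
  rw [range_fin_append', Ideal.span_union]
  refine Ideal.mem_minimalPrimes_of_height_eq ?_ (hd.symm.le.trans ht)
  exact sup_le (hxle.trans hPm) (Ideal.span_le.mpr (Set.range_subset_iff.mpr htm))

/-! ## Matsumura 17.3 (iii): Cohen–Macaulayness localizes -/

/-- **The head of a weakly regular concatenation is weakly regular**: if
`List.ofFn (Fin.append x t)` is weakly regular on `R`, so is `List.ofFn x`. [folklore] -/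
theorem isWeaklyRegular_ofFn_of_isWeaklyRegular_ofFn_append {R : Type*} [CommRing R] {h e : ℕ}
    (x : Fin h → R) (t : Fin e → R) (hreg : IsWeaklyRegular R (List.ofFn (Fin.append x t))) :
    IsWeaklyRegular R (List.ofFn x) := by
  rw [List.ofFn_fin_append] at hreg
  exact ((isWeaklyRegular_append_iff R (List.ofFn x) (List.ofFn t)).mp hreg).1

/-- **A weakly regular sequence inside `P` becomes a maximal regular sequence of `R_P` when its
length is `ht P`**: if `x : Fin h → R` is weakly regular on `R`, `x ⊆ P` and `ht P = h`, then the
image of `x` in a localization `S` of `R` at `P` is an `S`-regular sequence in the maximal ideal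
of `S` of length `dim S`, i.e. `S` is Cohen–Macaulay. [cite: Matsumura1987, Thm. 17.3 (iii)] -/
theorem exists_isRegular_map_of_isLocalization_atPrime {R : Type u} [CommRing R] (P : Ideal R)
    [P.IsPrime] (S : Type u) [CommRing S] [Algebra R S] [IsLocalization.AtPrime S P]
    [IsLocalRing S] {h : ℕ}
    (x : Fin h → R) (hreg : IsWeaklyRegular R (List.ofFn x)) (hxP : ∀ i, x i ∈ P)
    (hht : P.height = h) :
    ∃ rs : List S, IsRegular S rs ∧ (∀ r ∈ rs, r ∈ maximalIdeal S) ∧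
      (rs.length : WithBot ℕ∞) = ringKrullDim S := by
  have hmem : ∀ r ∈ List.ofFn x, r ∈ P := List.forall_mem_ofFn_iff.mpr hxP
  refine ⟨(List.ofFn x).map (algebraMap R S), hreg.isRegular_of_isLocalization_of_mem S P hmem,
    ?_, ?_⟩
  · intro r hr
    obtain ⟨a, ha, rfl⟩ := List.mem_map.mp hr
    exact (IsLocalization.AtPrime.to_map_mem_maximal_iff S P a).mpr (hmem a ha)
  · rw [List.length_map, List.length_ofFn, IsLocalization.AtPrime.ringKrullDim_eq_height P S, hht]
    rfl

/-- **Cohen–Macaulayness localizes** (Matsumura, Thm. 17.3 (iii); Bruns–Herzog, Thm. 2.1.3 (b)),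
in the tree's phrasing: if every system of parameters of the Noetherian local ring `R` is a weakly
regular sequence, then every localization `S` of `R` at a prime `P` (a local ring, `IsLocalization.AtPrime.isLocalRing`)
has an `S`-regular sequence in its maximal ideal of length `dim S`. Proof: `P` contains the head `x` (`ht P` elements) of a
system of parameters `(x, t)` (`exists_isSystemOfParameters_append`); `(x, t)` is weakly regular,
hence so is `x`, and its image in `S` is regular of length `ht P = dim S`.
[cite: Matsumura1987, Thm. 17.3 (iii)] -/
theorem exists_isRegular_of_isLocalization_atPrime {R : Type u} [CommRing R] [IsNoetherianRing R]
    [IsLocalRing R]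
    (hCM : ∀ ⦃n : ℕ⦄ (u : Fin n → R), IsSystemOfParameters u → IsWeaklyRegular R (List.ofFn u))
    (P : Ideal R) [P.IsPrime] (S : Type u) [CommRing S] [Algebra R S] [IsLocalization.AtPrime S P]
    [IsLocalRing S] :
    ∃ rs : List S, IsRegular S rs ∧ (∀ r ∈ rs, r ∈ maximalIdeal S) ∧
      (rs.length : WithBot ℕ∞) = ringKrullDim S := by
  obtain ⟨h, e, x, t, hxt, hxP, -, hht⟩ := exists_isSystemOfParameters_append R P
  exact exists_isRegular_map_of_isLocalization_atPrime P S x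
    (isWeaklyRegular_ofFn_of_isWeaklyRegular_ofFn_append x t (hCM _ hxt)) hxP hht

/-- **Cohen–Macaulayness localizes, inline-clause form** (Matsumura, Thm. 17.3 (iii) with
Thm. 17.4 (iii)): if every system of parameters of the Noetherian local ring `R` is a weakly
regular sequence — the stalkwise clause of `KawasakiMacaulayfication` — then the same holds for
every localization `S` of `R` at a prime ideal `P`. [cite: Matsumura1987, Thm. 17.3 (iii)] -/
theorem cmClause_of_isLocalization_atPrime {R : Type u} [CommRing R] [IsNoetherianRing R]
    [IsLocalRing R]
    (hR : ∀ d : ℕ, ringKrullDim R = d → ∀ s : Fin d → R, (Ideal.span (Set.range s)).radical.IsMaximal →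
      IsWeaklyRegular R (List.ofFn s))
    (P : Ideal R) [P.IsPrime] (S : Type u) [CommRing S] [Algebra R S] [IsLocalization.AtPrime S P] :
    ∀ d : ℕ, ringKrullDim S = d → ∀ s : Fin d → S, (Ideal.span (Set.range s)).radical.IsMaximal →
      IsWeaklyRegular S (List.ofFn s) := by
  haveI := IsLocalization.AtPrime.isLocalRing S P
  haveI : IsNoetherianRing S := IsLocalization.isNoetherianRing P.primeCompl S inferInstance
  have hCM : ∀ ⦃n : ℕ⦄ (u : Fin n → R), IsSystemOfParameters u → IsWeaklyRegular R (List.ofFn u) :=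
    fun n u hu => hR n hu.1 u (isSystemOfParameters_iff.mp hu).2
  exact cmClause_of_exists_isRegular (exists_isRegular_of_isLocalization_atPrime hCM P S)

/-- **Cohen–Macaulayness localizes, model form**: the clause passes from a Noetherian local ring
`R` to `Localization.AtPrime P` for every prime `P`. [cite: Matsumura1987, Thm. 17.3 (iii)] -/
theorem cmClause_localization_atPrime {R : Type u} [CommRing R] [IsNoetherianRing R]
    [IsLocalRing R]
    (hR : ∀ d : ℕ, ringKrullDim R = d → ∀ s : Fin d → R, (Ideal.span (Set.range s)).radical.IsMaximal →
      IsWeaklyRegular R (List.ofFn s))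
    (P : Ideal R) [P.IsPrime] :
    ∀ d : ℕ, ringKrullDim (Localization.AtPrime P) = d → ∀ s : Fin d → Localization.AtPrime P,
      (Ideal.span (Set.range s)).radical.IsMaximal →
        IsWeaklyRegular (Localization.AtPrime P) (List.ofFn s) :=
  cmClause_of_isLocalization_atPrime hR P (Localization.AtPrime P)

end Literature.AlgebraicGeometry.Resolution
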